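import Summits.ValiantsHypothesis.ValiantsHypothesis.Theorems.NewtonFramesTwoProductsFrameRungTwoTrinomialVertex

/-!
# Crux `TwoProducts` (stmt-5906), line `FrameRungTwo`: the open stub for TRINOMIAL frames without parallelogram coincidences

Last of four files (`…TrinomialWords`, `…TrinomialRigidity`, `…TrinomialVertex`).  Registered forward line
`Cruxes/TwoProducts/Lines/FrameRungTwo.lean`; its one open stub `stub_crossCancelCount` counts the cross-cancelling Newton
vertices of `k` products on two dissociated frames.  Landed before: `k ≤ 2, t ≤ 2` (`…FrameRungTwoBinomial.lean`) and, at crux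
level, all ARITHMETIC-PROGRESSION supports (`…TwoProductsAPSupports.lean`).  Here:

* `crossCancel_trinomial` — one product on each of two dissociated frames with `≤ t ≤ 3` letters per coordinate and NO
  PARALLELOGRAM COINCIDENCE (no word sum equals another word sum shifted by `x + y − 2c`, `c, x, y` three distinct letters of
  one coordinate, `c` the letter the second word uses there): cross-cancelling vertices `≤ (m t + 2)^6`;
* `crossCancelCount_le_three_of_noParallelogram` — the stub's statement VERBATIM restricted to `k ≤ 2`, `t ≤ 3`, plus that
  hypothesis on both frames (`C = 6`).

Proof: `vertex_form_three` puts every cross-cancelling vertex in the union of the floor-style covering sets (`mem_cover`,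
`card_cover_le` from the binomial file: top tuple with `≤ 1` demotion) and the trinomial-shape sets (`card_cover2_le`).
Consequence for the line: at `k = 2, t = 3` a counterexample to the stub — or to its algebra-free core (SD) — must use frames
with parallelogram coincidences that are NOT arithmetic progressions (uneven or L-shaped digit systems with carries); AP
frames are polynomial by `…APSupports`, coincidence-free frames by this file.
Honest scope: a `t`-variant (trinomial frames without parallelogram coincidences, `k ≤ 2`) of ONE stub of a rung strictly
below the crux `TwoProducts`; nothing here bears on the crux in general or on `VP ≠ VNP`. [ours; setting KPTT arXiv:1308.2286 §2, §5]
-/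

set_option linter.dupNamespace false

namespace Summit.ValiantsHypothesis.ValiantsHypothesis.Theorems.NewtonFramesTwoProducts.FrameRungTwoTrinomial

open MvPolynomial
open scoped BigOperators Classical
open Summit.ValiantsHypothesis.Theorems.DissociatedFixedK (lexKey lexKey_injective lexTop lexTop_mem lexKey_le_lexTop
  stub_topTupleCount count_arith)
open Summit.ValiantsHypothesis.ValiantsHypothesis.Theorems.DissociatedFixedK.Negative (emb emb_injective)
open Summit.ValiantsHypothesis.ValiantsHypothesis.Theorems.NewtonFramesTwoProducts.FrameRungTwoBinomial
  (emb_add emb_sum lexKey_sum apply_le_of_lexKey_le lexKey_lt_of_apply_lt lexKey_sum_lt_sum lexKey_sum_le_sum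
   eq_T_of_not_mem_filter ne_T_of_mem_filter lexKey_sum_lt_T lexKey_sum_le_T coeff_word exists_word prod_coeff_ne_zero
   top_eq mem_cover card_cover_le cross_empty_of_union_subset support_filter_sum_subset_one)

noncomputable section

section Main

variable {m : ℕ}

/-- **Cross-cancelling vertices for two dissociated frames with `≤ 3` letters and no parallelogram coincidences** (one product
on each frame): at most `(m t + 2)^6`. [ours; setting KPTT arXiv:1308.2286 §2] -/
theorem crossCancel_trinomial (m t : ℕ) (ht : t ≤ 3) (A B : Fin m → Finset (Fin 2 →₀ ℕ))
    (f g : Fin m → MvPolynomial (Fin 2) ℂ)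
    (hA : ∀ j, (A j).card ≤ t) (hB : ∀ j, (B j).card ≤ t)
    (hf : ∀ j, (f j).support ⊆ A j) (hg : ∀ j, (g j).support ⊆ B j)
    (hinjA : ∀ a b : Fin m → (Fin 2 →₀ ℕ), (∀ j, a j ∈ A j) → (∀ j, b j ∈ A j) → ∑ j, a j = ∑ j, b j → a = b)
    (hinjB : ∀ a b : Fin m → (Fin 2 →₀ ℕ), (∀ j, a j ∈ B j) → (∀ j, b j ∈ B j) → ∑ j, a j = ∑ j, b j → a = b)
    (hparA : ∀ (a a' : Fin m → (Fin 2 →₀ ℕ)) (p : Fin m) (x y : Fin 2 →₀ ℕ), (∀ j, a j ∈ A j) → (∀ j, a' j ∈ A j) →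
      x ∈ A p → y ∈ A p → x ≠ y → x ≠ a' p → y ≠ a' p → (∑ j, a j) + a' p + a' p ≠ (∑ j, a' j) + x + y)
    (hparB : ∀ (a a' : Fin m → (Fin 2 →₀ ℕ)) (p : Fin m) (x y : Fin 2 →₀ ℕ), (∀ j, a j ∈ B j) → (∀ j, a' j ∈ B j) →
      x ∈ B p → y ∈ B p → x ≠ y → x ≠ a' p → y ≠ a' p → (∑ j, a j) + a' p + a' p ≠ (∑ j, a' j) + x + y) :
    {p : Fin 2 → ℝ | p ∈ Set.extremePoints ℝ (convexHull ℝ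
          (emb '' ((∏ j, f j + ∏ j, g j).support : Set (Fin 2 →₀ ℕ)))) ∧
        ∃ l : (Fin 2 → ℝ) →ₗ[ℝ] ℝ,
          (∀ q ∈ emb '' ((∏ j, f j + ∏ j, g j).support : Set (Fin 2 →₀ ℕ)), q ≠ p → l q < l p) ∧
          ∃ q ∈ emb '' ((∏ j, f j).support : Set (Fin 2 →₀ ℕ)) ∪ emb '' ((∏ j, g j).support : Set (Fin 2 →₀ ℕ)),
            l p < l q}.ncard ≤ (m * t + 2) ^ 6 := by
  by_cases h0 : (∀ j, f j ≠ 0) ∧ (∀ j, g j ≠ 0)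
  swap
  · have hsub : (∏ j, f j).support ∪ (∏ j, g j).support ⊆ (∏ j, f j + ∏ j, g j).support := by
      rw [not_and_or] at h0
      rcases h0 with h | h
      · push Not at h
        obtain ⟨j, hj⟩ := h
        rw [Finset.prod_eq_zero (Finset.mem_univ j) hj, support_zero, Finset.empty_union, zero_add]
      · push Not at h
        obtain ⟨j, hj⟩ := h
        rw [Finset.prod_eq_zero (Finset.mem_univ j) hj, support_zero, Finset.union_empty, add_zero]
    rw [cross_empty_of_union_subset _ _ _ hsub, Set.ncard_empty]
    exact Nat.zero_le _
  obtain ⟨hf0, hg0⟩ := h0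
  have hnef : ∀ j, ((f j).support).Nonempty := fun j => by
    rw [Finset.nonempty_iff_ne_empty, Ne, MvPolynomial.support_eq_empty]; exact hf0 j
  have hneg : ∀ j, ((g j).support).Nonempty := fun j => by
    rw [Finset.nonempty_iff_ne_empty, Ne, MvPolynomial.support_eq_empty]; exact hg0 j
  have hSf : ∀ j, ((f j).support).card ≤ t := fun j => (Finset.card_le_card (hf j)).trans (hA j)
  have hSg : ∀ j, ((g j).support).card ≤ t := fun j => (Finset.card_le_card (hg j)).trans (hB j)
  have hinjf : ∀ a b : Fin m → (Fin 2 →₀ ℕ), (∀ j, a j ∈ (f j).support) → (∀ j, b j ∈ (f j).support) →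
      ∑ j, a j = ∑ j, b j → a = b := fun a b ha hb => hinjA a b (fun j => hf j (ha j)) (fun j => hf j (hb j))
  have hinjg : ∀ a b : Fin m → (Fin 2 →₀ ℕ), (∀ j, a j ∈ (g j).support) → (∀ j, b j ∈ (g j).support) →
      ∑ j, a j = ∑ j, b j → a = b := fun a b ha hb => hinjB a b (fun j => hg j (ha j)) (fun j => hg j (hb j))
  -- covering finsets
  set U1f : Finset (Fin 2 → ℝ) := ((Fintype.piFinset fun j => (f j).support).filter fun b =>
        ∃ l : (Fin 2 → ℝ) →L[ℝ] ℝ, ∀ j, ∀ x ∈ (f j).support, lexKey l x ≤ lexKey l (b j)).biUnion fun b =>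
      (Finset.insertNone (Finset.univ.biUnion fun j => ((f j).support).image (Prod.mk j))).image fun o =>
        emb (∑ j, Option.elim o b (fun p => Function.update b p.1 p.2) j) with hU1f
  set U1g : Finset (Fin 2 → ℝ) := ((Fintype.piFinset fun j => (g j).support).filter fun b =>
        ∃ l : (Fin 2 → ℝ) →L[ℝ] ℝ, ∀ j, ∀ x ∈ (g j).support, lexKey l x ≤ lexKey l (b j)).biUnion fun b =>
      (Finset.insertNone (Finset.univ.biUnion fun j => ((g j).support).image (Prod.mk j))).image fun o =>
        emb (∑ j, Option.elim o b (fun p => Function.update b p.1 p.2) j) with hU1g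
  set U2f : Finset (Fin 2 → ℝ) := ((Fintype.piFinset fun j => (f j).support).filter fun b =>
        ∃ l : (Fin 2 → ℝ) →L[ℝ] ℝ, ∀ j, ∀ x ∈ (f j).support, lexKey l x ≤ lexKey l (b j)).biUnion fun b =>
      Finset.univ.biUnion fun p => (((f p).support) ×ˢ ((f p).support)).image fun yy =>
        emb (∑ j, b j) - (emb (b p) - emb yy.1) - (emb (b p) - emb yy.2) with hU2f
  set U2g : Finset (Fin 2 → ℝ) := ((Fintype.piFinset fun j => (g j).support).filter fun b =>
        ∃ l : (Fin 2 → ℝ) →L[ℝ] ℝ, ∀ j, ∀ x ∈ (g j).support, lexKey l x ≤ lexKey l (b j)).biUnion fun b =>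
      Finset.univ.biUnion fun p => (((g p).support) ×ˢ ((g p).support)).image fun yy =>
        emb (∑ j, b j) - (emb (b p) - emb yy.1) - (emb (b p) - emb yy.2) with hU2g
  have hmem2 : ∀ (lc : (Fin 2 → ℝ) →L[ℝ] ℝ) (g' : Fin m → MvPolynomial (Fin 2) ℂ) (T' : Fin m → (Fin 2 →₀ ℕ)),
      (∀ j, T' j ∈ (g' j).support) → (∀ j, ∀ x ∈ (g' j).support, lexKey lc x ≤ lexKey lc (T' j)) →
      ∀ (p : Fin m) (y₁ y₂ : Fin 2 →₀ ℕ), y₁ ∈ (g' p).support → y₂ ∈ (g' p).support →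
      emb (∑ j, T' j) - (emb (T' p) - emb y₁) - (emb (T' p) - emb y₂) ∈
        ((Fintype.piFinset fun j => (g' j).support).filter fun b =>
          ∃ l : (Fin 2 → ℝ) →L[ℝ] ℝ, ∀ j, ∀ x ∈ (g' j).support, lexKey l x ≤ lexKey l (b j)).biUnion fun b =>
        Finset.univ.biUnion fun p => (((g' p).support) ×ˢ ((g' p).support)).image fun yy =>
          emb (∑ j, b j) - (emb (b p) - emb yy.1) - (emb (b p) - emb yy.2) := by
    intro lc g' T' hT' hTmax' p y₁ y₂ hy₁ hy₂
    refine Finset.mem_biUnion.2 ⟨T', Finset.mem_filter.2 ⟨Fintype.mem_piFinset.2 hT', lc, hTmax'⟩, ?_⟩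
    refine Finset.mem_biUnion.2 ⟨p, Finset.mem_univ _, Finset.mem_image.2 ⟨(y₁, y₂), ?_, rfl⟩⟩
    exact Finset.mem_product.2 ⟨hy₁, hy₂⟩
  have hcover : {p : Fin 2 → ℝ | p ∈ Set.extremePoints ℝ (convexHull ℝ
          (emb '' ((∏ j, f j + ∏ j, g j).support : Set (Fin 2 →₀ ℕ)))) ∧
        ∃ l : (Fin 2 → ℝ) →ₗ[ℝ] ℝ,
          (∀ q ∈ emb '' ((∏ j, f j + ∏ j, g j).support : Set (Fin 2 →₀ ℕ)), q ≠ p → l q < l p) ∧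
          ∃ q ∈ emb '' ((∏ j, f j).support : Set (Fin 2 →₀ ℕ)) ∪ emb '' ((∏ j, g j).support : Set (Fin 2 →₀ ℕ)),
            l p < l q} ⊆ ↑((U1f ∪ U1g) ∪ (U2f ∪ U2g)) := by
    rintro p ⟨hp, l, hl, q, hq, hlt⟩
    obtain ⟨e, he, rfl⟩ := extremePoints_convexHull_subset hp
    have he' : e ∈ (∏ j, f j + ∏ j, g j).support := he
    set lc : (Fin 2 → ℝ) →L[ℝ] ℝ := LinearMap.toContinuousLinearMap l with hlc
    have hlcl : ∀ v, lc v = l v := fun v => rfl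
    -- key-top tuples
    set T : Fin m → (Fin 2 →₀ ℕ) := fun j => lexTop lc ((f j).support) (hnef j) with hTdef
    set T' : Fin m → (Fin 2 →₀ ℕ) := fun j => lexTop lc ((g j).support) (hneg j) with hT'def
    have hT : ∀ j, T j ∈ (f j).support := fun j => lexTop_mem _ _ _
    have hT' : ∀ j, T' j ∈ (g j).support := fun j => lexTop_mem _ _ _
    have hTmax : ∀ j, ∀ x ∈ (f j).support, lexKey lc x ≤ lexKey lc (T j) := fun j x hx => lexKey_le_lexTop _ _ _ hx
    have hTmax' : ∀ j, ∀ x ∈ (g j).support, lexKey lc x ≤ lexKey lc (T' j) := fun j x hx => lexKey_le_lexTop _ _ _ hx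
    have hparf : ∀ (a : Fin m → (Fin 2 →₀ ℕ)) (p : Fin m) (x y : Fin 2 →₀ ℕ), (∀ j, a j ∈ (f j).support) →
        x ∈ (f p).support → y ∈ (f p).support → x ≠ y → x ≠ T p → y ≠ T p →
        (∑ j, a j) + T p + T p ≠ (∑ j, T j) + x + y := fun a p x y ha hx hy hxy hxT hyT =>
      hparA a T p x y (fun j => hf j (ha j)) (fun j => hf j (hT j)) (hf p hx) (hf p hy) hxy hxT hyT
    have hparg : ∀ (a : Fin m → (Fin 2 →₀ ℕ)) (p : Fin m) (x y : Fin 2 →₀ ℕ), (∀ j, a j ∈ (g j).support) →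
        x ∈ (g p).support → y ∈ (g p).support → x ≠ y → x ≠ T' p → y ≠ T' p →
        (∑ j, a j) + T' p + T' p ≠ (∑ j, T' j) + x + y := fun a p x y ha hx hy hxy hxT hyT =>
      hparB a T' p x y (fun j => hg j (ha j)) (fun j => hg j (hT' j)) (hg p hx) (hg p hy) hxy hxT hyT
    have hzero : ∀ x : Fin 2 →₀ ℕ, x ≠ e → lc (emb e) ≤ lc (emb x) →
        coeff x (∏ j, f j) + coeff x (∏ j, g j) = 0 := by
      intro x hxe hle
      by_contra hne
      have hx : x ∈ (∏ j, f j + ∏ j, g j).support := by rw [mem_support_iff, coeff_add]; exact hne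
      have h := hl (emb x) ⟨x, hx, rfl⟩ (fun h => hxe (emb_injective h))
      rw [hlcl, hlcl] at hle
      exact absurd h (not_lt.2 hle)
    have hzero' : ∀ x : Fin 2 →₀ ℕ, x ≠ e → lc (emb e) ≤ lc (emb x) →
        coeff x (∏ j, g j) + coeff x (∏ j, f j) = 0 := fun x hx hle => by rw [add_comm]; exact hzero x hx hle
    have heF : coeff e (∏ j, f j) + coeff e (∏ j, g j) ≠ 0 := by
      rw [← coeff_add]; exact mem_support_iff.1 he'
    have heF' : coeff e (∏ j, g j) + coeff e (∏ j, f j) ≠ 0 := by rwa [add_comm]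
    have htops : ∑ j, T j = ∑ j, T' j ∧ lexKey lc e < lexKey lc (∑ j, T j) := by
      rcases hq with ⟨x, hx, rfl⟩ | ⟨x, hx, rfl⟩
      · exact top_eq lc f g T T' hT hTmax hT' hTmax' hinjf hinjg e hzero ⟨x, hx, by rwa [hlcl, hlcl]⟩
      · have h := top_eq lc g f T' T hT' hTmax' hT hTmax hinjg hinjf e hzero' ⟨x, hx, by rwa [hlcl, hlcl]⟩
        refine ⟨h.1.symm, ?_⟩
        rw [← h.1]; exact h.2
    obtain ⟨htop, hTe⟩ := htops
    have hTe' : lexKey lc e < lexKey lc (∑ j, T' j) := htop ▸ hTe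
    rw [Finset.coe_union, Finset.coe_union, Finset.coe_union]
    rcases Finset.mem_union.1 (support_add he') with hef | heg
    · obtain ⟨a, ha, hae⟩ := exists_word f hinjf hef
      rcases vertex_form_three lc f g T T' hT hTmax hT' hTmax' hinjf hinjg hparf hparg e hzero htop hTe ha hae heF with
        hc | ⟨p', y₁, y₂, hy₁, hy₂, -, -, -, hE⟩
      · rw [← hae]
        exact Or.inl (Or.inl (mem_cover lc f T hT hTmax a ha hc))
      · rw [hE]
        exact Or.inr (Or.inr (hmem2 lc g T' hT' hTmax' p' y₁ y₂ hy₁ hy₂))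
    · obtain ⟨a, ha, hae⟩ := exists_word g hinjg heg
      rcases vertex_form_three lc g f T' T hT' hTmax' hT hTmax hinjg hinjf hparg hparf e hzero' htop.symm hTe' ha hae heF'
        with hc | ⟨p', y₁, y₂, hy₁, hy₂, -, -, -, hE⟩
      · rw [← hae]
        exact Or.inl (Or.inr (mem_cover lc g T' hT' hTmax' a ha hc))
      · rw [hE]
        exact Or.inr (Or.inl (hmem2 lc f T hT hTmax p' y₁ y₂ hy₁ hy₂))
  calc _ ≤ (↑((U1f ∪ U1g) ∪ (U2f ∪ U2g)) : Set (Fin 2 → ℝ)).ncard := Set.ncard_le_ncard hcover (Finset.finite_toSet _)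
    _ = ((U1f ∪ U1g) ∪ (U2f ∪ U2g)).card := Set.ncard_coe_finset _
    _ ≤ (U1f.card + U1g.card) + (U2f.card + U2g.card) :=
        (Finset.card_union_le _ _).trans (Nat.add_le_add (Finset.card_union_le _ _) (Finset.card_union_le _ _))
    _ ≤ ((m * t + 1) * (4 * (m * t) ^ 2 + 7) + (m * t + 1) * (4 * (m * t) ^ 2 + 7)) +
        ((4 * (m * t) ^ 2 + 7) * (m * (t * t)) + (4 * (m * t) ^ 2 + 7) * (m * (t * t))) :=
        Nat.add_le_add (Nat.add_le_add (card_cover_le t f hSf) (card_cover_le t g hSg))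
          (Nat.add_le_add (card_cover2_le t f hSf) (card_cover2_le t g hSg))
    _ = 2 * ((m * t + 1) * (4 * (m * t) ^ 2 + 7)) + 2 * ((4 * (m * t) ^ 2 + 7) * (m * (t * t))) := by ring
    _ ≤ (m * t + 2) ^ 6 := count_arith_three m t ht

end Main

/-! ## The registered stub for `k ≤ 2`, `t ≤ 3`, frames without parallelogram coincidences -/

section Stub

/-- **`stub_crossCancelCount` for `k ≤ 2`, `t ≤ 3` and frames WITHOUT PARALLELOGRAM COINCIDENCES**, with `C = 6`: the
registered stub of line `FrameRungTwo` (crux `TwoProducts`, stmt-5906) restricted to at most two products and letter sets of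
size at most three, under the extra hypothesis that in each frame no word sum equals another word sum shifted by `x + y − 2c`
for three distinct letters `c, x, y` of one coordinate (`c` the letter used by the second word there).  Statement otherwise
verbatim.  With both products on one frame, or fewer than two products, one class is empty and there is no cross-cancelling
vertex; with one product on each frame this is `crossCancel_trinomial`. [ours; setting KPTT arXiv:1308.2286 §2] -/
theorem crossCancelCount_le_three_of_noParallelogram : ∀ k ≤ 2, ∃ C : ℕ, ∀ (m t : ℕ), t ≤ 3 →
    ∀ (A : Fin 2 → Fin m → Finset (Fin 2 →₀ ℕ)) (c : Fin k → Fin 2) (f : Fin k → Fin m → MvPolynomial (Fin 2) ℂ),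
    (∀ σ j, (A σ j).card ≤ t) →
    (∀ i j, (f i j).support ⊆ A (c i) j) →
    (∀ σ, ∀ a b : Fin m → (Fin 2 →₀ ℕ), (∀ j, a j ∈ A σ j) → (∀ j, b j ∈ A σ j) →
        ∑ j, a j = ∑ j, b j → a = b) →
    (∀ σ, ∀ (a a' : Fin m → (Fin 2 →₀ ℕ)) (p : Fin m) (x y : Fin 2 →₀ ℕ), (∀ j, a j ∈ A σ j) → (∀ j, a' j ∈ A σ j) →
        x ∈ A σ p → y ∈ A σ p → x ≠ y → x ≠ a' p → y ≠ a' p → (∑ j, a j) + a' p + a' p ≠ (∑ j, a' j) + x + y) →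
    {p : Fin 2 → ℝ | p ∈ Set.extremePoints ℝ (convexHull ℝ (emb ''
          ((∑ i, ∏ j, f i j).support : Set (Fin 2 →₀ ℕ)))) ∧
        ∃ l : (Fin 2 → ℝ) →ₗ[ℝ] ℝ,
          (∀ q ∈ emb '' ((∑ i, ∏ j, f i j).support : Set (Fin 2 →₀ ℕ)), q ≠ p → l q < l p) ∧
          ∃ q ∈ emb '' ((∑ i ∈ Finset.univ.filter (fun i => c i = 0), ∏ j, f i j).support
                          : Set (Fin 2 →₀ ℕ)) ∪
                 emb '' ((∑ i ∈ Finset.univ.filter (fun i => c i = 1), ∏ j, f i j).support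
                          : Set (Fin 2 →₀ ℕ)),
            l p < l q}.ncard ≤ (m * t + 2) ^ C := by
  intro k hk
  refine ⟨6, ?_⟩
  intro m t ht A c f hA hf hinj hpar
  interval_cases k
  · rw [cross_empty_of_union_subset _ _ _ (by simp), Set.ncard_empty]
    exact Nat.zero_le _
  · rw [cross_empty_of_union_subset _ _ _ (Finset.union_subset (support_filter_sum_subset_one _)
      (support_filter_sum_subset_one _)), Set.ncard_empty]
    exact Nat.zero_le _
  · by_cases hc : c 0 = c 1
    · have hsub : ∀ σ : Fin 2, (∑ i ∈ Finset.univ.filter (fun i => c i = σ), ∏ j, f i j).support ⊆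
          (∑ i, ∏ j, f i j).support := by
        intro σ
        by_cases h : c 0 = σ
        · have : Finset.univ.filter (fun i => c i = σ) = Finset.univ := by
            ext i; fin_cases i <;> simp [h, ← hc]
          rw [this]
        · have : Finset.univ.filter (fun i => c i = σ) = ∅ := by
            ext i; fin_cases i <;> simp [h, ← hc]
          rw [this, Finset.sum_empty, support_zero]
          exact Finset.empty_subset _
      rw [cross_empty_of_union_subset _ _ _ (Finset.union_subset (hsub 0) (hsub 1)), Set.ncard_empty]
      exact Nat.zero_le _
    · have hsum : (∑ i, ∏ j, f i j) = ∏ j, f 0 j + ∏ j, f 1 j := Fin.sum_univ_two _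
      have key : ∀ x : Fin 2, x = 0 ∨ x = 1 := by decide
      rcases key (c 0) with h0 | h0 <;> rcases key (c 1) with h1 | h1
      · exact absurd (h0.trans h1.symm) hc
      · have e0 : (∑ i ∈ Finset.univ.filter (fun i => c i = 0), ∏ j, f i j) = ∏ j, f 0 j := by
          have : Finset.univ.filter (fun i => c i = 0) = {0} := by ext i; fin_cases i <;> simp [h0, h1]
          rw [this, Finset.sum_singleton]
        have e1 : (∑ i ∈ Finset.univ.filter (fun i => c i = 1), ∏ j, f i j) = ∏ j, f 1 j := by
          have : Finset.univ.filter (fun i => c i = 1) = {1} := by ext i; fin_cases i <;> simp [h0, h1]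
          rw [this, Finset.sum_singleton]
        rw [hsum, e0, e1]
        exact crossCancel_trinomial m t ht (A 0) (A 1) (f 0) (f 1) (hA 0) (hA 1)
          (fun j => by have := hf 0 j; rwa [h0] at this) (fun j => by have := hf 1 j; rwa [h1] at this)
          (hinj 0) (hinj 1) (hpar 0) (hpar 1)
      · have e0 : (∑ i ∈ Finset.univ.filter (fun i => c i = 0), ∏ j, f i j) = ∏ j, f 1 j := by
          have : Finset.univ.filter (fun i => c i = 0) = {1} := by ext i; fin_cases i <;> simp [h0, h1]
          rw [this, Finset.sum_singleton]
        have e1 : (∑ i ∈ Finset.univ.filter (fun i => c i = 1), ∏ j, f i j) = ∏ j, f 0 j := by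
          have : Finset.univ.filter (fun i => c i = 1) = {0} := by ext i; fin_cases i <;> simp [h0, h1]
          rw [this, Finset.sum_singleton]
        rw [hsum, e0, e1, add_comm]
        exact crossCancel_trinomial m t ht (A 0) (A 1) (f 1) (f 0) (hA 0) (hA 1)
          (fun j => by have := hf 1 j; rwa [h1] at this) (fun j => by have := hf 0 j; rwa [h0] at this)
          (hinj 0) (hinj 1) (hpar 0) (hpar 1)
      · exact absurd (h0.trans h1.symm) hc

end Stub

end

end Summit.ValiantsHypothesis.ValiantsHypothesis.Theorems.NewtonFramesTwoProducts.FrameRungTwoTrinomial
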